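import Summits.QuantumFields.YangMills.Theses.ThermalDescent
import HarnessLib

/-!
# Route `ThermalDescent` — glue of the split of `ZeroTemperatureFloors` (LINE B, ideator ym-idea-6 g7)

`theorem thermalDescent_zeroTemperatureFloorsGlue : ThermalDescent.ZeroTemperatureFloorsGlue`, i.e.
`HighBallFloors → DivisibleBump → ZeroTemperatureFloors` (items stmt-QuantumFields-28191, 28193 ⟹ 25390; glue item
stmt-QuantumFields-28222): the `ρ = 1/2` high bump `f` of `DivisibleBump` is non-negative, non-zero and supported in
`closedBall(2e₀, 1/2) ⊆ {1 < y₀ < 3}`, so its `HighBallFloors` cylinder floor in the unit `(r, a)` is a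
`ZeroTemperatureFloors` witness with `δ₁ = 1`, `δ₂ = 3`.

R3/RECORD framing: an implication between OPEN items (split glue); neither crux, nor NT (19353), nor the Yang–Mills
mass gap is proved here.
-/

set_option autoImplicit false

namespace Summit.QuantumFields.YangMills.Theorems

open Summit.QuantumFields.YangMills.Theses.ThermalDescent in
/-- Glue of the gen-1 split of `ZeroTemperatureFloors` into `HighBallFloors` + `DivisibleBump` (closes item 28222). -/
theorem thermalDescent_zeroTemperatureFloorsGlue :
    Summit.QuantumFields.YangMills.Theses.ThermalDescent.ZeroTemperatureFloorsGlue := by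
  intro hH hD G _ _ _ _ hG
  letI : MeasurableSpace G := borel G
  haveI : BorelSpace G := ⟨rfl⟩
  obtain ⟨r, a, ha, ha0, hfl⟩ := hH G hG
  obtain ⟨v, f, hv0, hvball, _, hf0, hfne, hfball, c, s₀, hc, hs₀, hdom⟩ := hD (1 / 2) one_half_pos
  obtain ⟨ε, β₅, Λ₅, hε, hfloor⟩ := hfl f hf0 hfne hfball
  refine ⟨r, a, ha, ha0, f, 1, 3, ε, β₅, Λ₅, one_pos, ?_, hε, hfloor⟩
  intro y hy
  have h := hfball hy
  rw [Metric.mem_closedBall, dist_eq_norm] at h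
  have h0 := PiLp.norm_apply_le (y - EuclideanSpace.single (0 : Fin 4) (2 : ℝ)) 0
  have h0' : ‖(y - EuclideanSpace.single (0 : Fin 4) (2 : ℝ)) 0‖ = |y 0 - 2| := by
    simp [Real.norm_eq_abs]
  rw [h0'] at h0
  have h2 := h0.trans h
  simp only [Set.mem_setOf_eq]
  rcases abs_le.mp h2 with ⟨h1, h3⟩
  constructor <;> linarith


end Summit.QuantumFields.YangMills.Theorems
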